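import Summits.Langlands.Langlands.Statement
import Literature.NumberTheory.Automorphic.AutomorphicInductionUnitaryCharacterCubic
import Literature.NumberTheory.Automorphic.BaseChangeInductionAlong
import Literature.NumberTheory.Automorphic.IsAutomorphicAE
import HarnessLib

/-!
# F3 `_special` — the floor is LITERALLY the family at `m = 1` (line `CubicInductionGL2`, crux
`ReciprocityUpToIrreducibility`, item stmt-Langlands-14328; G4 ladder-down generation 23)

`floor_one : automorphicInduction_unitaryCharacter_cubic → CubicInducedReciprocity 1`: clause (1) of the in-tree named fact
(Jacquet–Piatetski-Shapiro–Shalika 1979 via Gelbart 1997 Thm. 5.3.1 / Rem. (e), `E/F` cubic NOT assumed Galois, `F` ANY number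
field) hands over the automorphic `π` of `GL₃(𝔸_F)` whose a.e. Satake polynomials are `∏_{w ∣ v}(X^{f(w|v)} − ω(ϖ_w))` for the
unitary Hecke character `ω` = the central character of the rank-one cuspidal `π_E` (`ω(ϖ_w) = ∏ t_{π_E,w}`; a `GL₁` Satake parameter is a
singleton, `HasSatakeParamAt.card_eq`), and that product IS the Arthur–Clozel induced polynomial of the Satake data of `π_E`
(`finprod_under_eq_inducedSatakePolynomial`, `inducedSatakePolynomial_congr`); the family's Frobenius hypothesis on `ρ` turns it into
`SatakeFrobCompatibleAE ι π ρ`.  Witness regime: ALL number fields `F`, ALL cubics `E/F` (S = `GL₃`-reciprocity is known over no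
number field in this generality) — a calibrated rung (TRIBUNAL-FIT F9 (i)).  No `sorry`.
-/

noncomputable section

set_option linter.dupNamespace false

open scoped MatrixGroups Matrix NumberField Classical Polynomial
open Filter IsDedekindDomain Field Polynomial NumberField
open Literature.NumberTheory.Automorphic Literature.NumberTheory.GaloisRepresentations
open Literature.NumberTheory.PAdicHodge
open Summit.Langlands

namespace Summit.Langlands.Langlands.Cruxes.ReciprocityUpToIrreducibility.CubicInductionGL2

/-- **The RUNG FAMILY, dial = the rank `m` of the induced representation** (verbatim as in `_onpath` / `_special`):
for all number fields `F`, all CUBIC extensions `E/F` (ANY Galois closure: `C₃` or `S₃`), all cuspidal automorphic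
`π_E` of `GL_m(𝔸_E)` (`0 < m`) with UNITARY central character (the Hecke character `ω` with `ω(ϖ_w) = det t_{π_E,w}`,
Borel–Jacquet 5.7; at `m = 1` this is the floor's `θ.IsUnitary`), all `ℓ, ι` and all framed
`ρ : Γ_F → GL_{3m}(ℚ̄_ℓ)` which are irreducible, de Rham above `ℓ` (Fontaine's pinned datum) and, at almost every place
`v`, unramified with Frobenius characteristic polynomial the `ι`-transport of the Arthur–Clozel induced polynomial
`∏_{w ∣ v} P_{π_E,w}(X^{f(w|v)})` of the Satake data of `π_E` above `v` (through any multiset `α` of its roots, in the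
dictionary `arithFrobPolyOfSatake`): `ρ` is attached at almost all places to an automorphic representation of
`GL_{3m}(𝔸_F)`. -/
def CubicInducedReciprocity (m : ℕ) : Prop :=
  ∀ (F E : Type) [Field F] [NumberField F] [Field E] [NumberField E] [Algebra F E],
    Module.finrank F E = 3 → 0 < m →
    ∀ (hE : isCompact_glFiniteIntegralLevel m E) (πE : CuspidalAutomorphicRepData m E hE),
      (∃ ω : HeckeCharacter E, ω.IsUnitary ∧
          ∀ (w : HeightOneSpectrum (𝓞 E)) (α : Multiset ℂ), πE.1.HasSatakeParamAt w α →
            ω.valueAtUniformizer w = α.prod) →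
      ∀ (hF : isCompact_glFiniteIntegralLevel (3 * m) F) (ℓ : ℕ) [Fact ℓ.Prime] (ι : PadicAlgCl ℓ ≃+* ℂ)
        (ρ : FramedGaloisRep F (PadicAlgCl ℓ) (3 * m)),
        ρ.toGaloisRep.IsIrreducible →
        (∀ (w : HeightOneSpectrum (𝓞 F)) (hw : ((ℓ : ℕ) : 𝓞 F) ∈ w.asIdeal),
            (fontainePstAdicCompletion w ℓ hw).IsDeRhamFramed (ρ.toLocal w)) →
        (∀ᶠ v : HeightOneSpectrum (𝓞 F) in cofinite, ρ.IsUnramifiedAt v ∧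
            ∀ β : HeightOneSpectrum (𝓞 E) → Multiset ℂ,
              (∀ w : HeightOneSpectrum (𝓞 E), w.asIdeal.under (𝓞 F) = v.asIdeal →
                  πE.1.HasSatakeParamAt w (β w)) →
              ∀ α : Multiset ℂ, satakePolynomial α = inducedSatakePolynomial v β →
                ρ.HasFrobCharpolyAt v (arithFrobPolyOfSatake ι v.residueCard 1 α)) →
        ∃ π : AutomorphicRepData (AutomorphyDatum.gl (3 * m) F hF), SatakeFrobCompatibleAE ι π ρ

/-- **F3: the family at `m = 1` IS the floor** (JPSS 1979, clause (1) of the in-tree named fact): a cuspidal `π_E` on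
`GL₁/E` with unitary central character `ω` has Satake parameter `{ω(ϖ_w)}` at every unramified `w` (a Satake parameter
of `GL₁` is a singleton, `HasSatakeParamAt.card_eq`), so the induced polynomial of `π_E` is the floor's
`∏_{w ∣ v} (X^{f(w|v)} - ω(ϖ_w))` (`finprod_under_eq_inducedSatakePolynomial`). -/
theorem floor_one (h : automorphicInduction_unitaryCharacter_cubic) : CubicInducedReciprocity 1 := by
  intro F E _ _ _ _ _ h3 _hm hE πE hω hF ℓ _ ι ρ _hirr _hdR hfrob
  obtain ⟨ω, hωu, hω⟩ := hω
  obtain ⟨π, hπ⟩ := (h F E h3 ω hωu hF).1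
  have hπ' : ∀ᶠ v : HeightOneSpectrum (𝓞 F) in cofinite, ∃ α : Multiset ℂ, π.HasSatakeParamAt v α ∧
      satakePolynomial α = inducedSatakePolynomial v (fun w => ({ω.valueAtUniformizer w} : Multiset ℂ)) :=
    hπ.mono fun v ⟨α, hα, hp⟩ =>
      ⟨α, hα, (satakePolynomial_eq_finprod_iff_eq_inducedSatakePolynomial ω v α).1 hp⟩
  refine ⟨π, ?_⟩
  filter_upwards [hπ', hfrob, πE.1.eventually_exists_forall_hasSatakeParamAt_above (K := F)] with v ⟨α, hα, hpoly⟩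
    ⟨hunr, hfr⟩ ⟨β, hβ⟩
  refine ⟨α, hα, hunr, hfr β hβ α ?_⟩
  rw [hpoly]
  refine inducedSatakePolynomial_congr v fun w hw => ?_
  have hsat := hβ w hw
  obtain ⟨b, hb⟩ := Multiset.card_eq_one.1 hsat.card_eq
  have hval := hω w (β w) hsat
  rw [hb, Multiset.prod_singleton] at hval
  rw [hb, hval]

/-- The rank-zero member is vacuous (`0 < m`). -/
theorem family_zero : CubicInducedReciprocity 0 := by
  intro F E _ _ _ _ _ _ hm
  exact absurd hm (lt_irrefl 0)

/-- The instantiation, as the brief asks (`example : Rung θ₀ := … floor`). -/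
example (h : automorphicInduction_unitaryCharacter_cubic) : CubicInducedReciprocity 1 := floor_one h


end Summit.Langlands.Langlands.Cruxes.ReciprocityUpToIrreducibility.CubicInductionGL2

end
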